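import Literature.AlgebraicGeometry.Resolution.SurfaceResolutionFunctorial
import Literature.AlgebraicGeometry.Resolution.AlterationsBlowupDivisorProofs
import Literature.AlgebraicGeometry.Resolution.QuasiExcellentSchemesProofs
import Literature.AlgebraicGeometry.Resolution.CofinalityFromPrincipalization
import Literature.AlgebraicGeometry.Resolution.SigmaMaxEliminationInDim
import Literature.AlgebraicGeometry.Resolution.ExcellentRingsFieldProofs
import Literature.AlgebraicGeometry.Resolution.CanonicalResolutionProofs
import Literature.AlgebraicGeometry.Resolution.RegularLocusDense
import Literature.AlgebraicGeometry.Resolution.FunctorialResolutionAutomorphisms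
import Literature.AlgebraicGeometry.Resolution.ProjectiveResolutionProofs
import Literature.AlgebraicGeometry.Morphisms.IsoOverOpen
import HarnessLib

/-!
# Kollár's lifting fact in dimension ≤ 2 from the Cossart–Jannsen–Saito canonical resolution (CJS 2020, Thm. 1.2; Kollár 2007, Thm. 3.36 + §3.4.1)

Topic: `Literature/AlgebraicGeometry/Resolution`. Theorems only (no definition, no new named fact).

GIVEN the tree's named fact `CossartJannsenSaito2020SequenceFunctorial` (CJS Thm. 1.2 with canonicity and the
Zariski-localisation functoriality `𝓢 U = (𝓢 X|_U).prune`), an integral PROJECTIVE scheme `X` of dimension `≤ 2` over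
ANY field `k` satisfies the conclusion of Kollár's `Kollar2007_resolutionLiftsAutomorphisms` (which the tree states in
characteristic `0` and all dimensions): the composite `r : Y = X_n → X` of the canonical sequence is a resolution
(CJS: centres in the singular loci, so `r` is an isomorphism over `Reg X`, `isResolution_comp`), `Y` is projective
(blow-ups of projective schemes are projective, Hartshorne II 7.16 (c), `IsBlowup.isProjectiveOver`), `r` is an
isomorphism over every open of regular points, and every automorphism `φ` of `X` lifts — because `φ` is an open
immersion `X ⟶ X`, so `𝓢 X = (𝓢 X|_φ).prune` and `pruneι ≫ restrictι` transports to a lift. Group actions then lift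
equivariantly (`ActionOver.resolutionLift`, Kollár §3.4.1).

* `CentreSeq.isProjectiveOver_top` — the top of a blow-up sequence over a projective `k`-scheme is projective.
* `CossartJannsenSaito2020SequenceFunctorial.kollar336_conclusion_of_dim_le_two` — the four clauses at `X`.
* `CossartJannsenSaito2020SequenceFunctorial.exists_actionOver_of_dim_le_two` — with a lifted group action.

Intended consumer: the `Q₈`-surface `N` over `Frac ℂ[a]` of `HodgeTheory/QuaternionicQuarticGenericModelOfLifting.lean`
(route `HodgeConjecture/Q8SymplecticPowers`, crux K1Q): its hypothesis is exactly `exists_actionOver_of_dim_le_two`.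

Honest scope: conditional on the CJS named fact (surfaces); nothing here bears on any summit.

## References

* [CossartJannsenSaito2020] V. Cossart, U. Jannsen, S. Saito, Desingularization: invariants and strategy (LNM 2270,
  2020), Thm. 1.2 (p. 5).
* [Kollar2007] J. Kollár, Lectures on Resolution of Singularities (2007), Thm. 3.36, §3.4.1 (p. 121).
* [Hartshorne1977] R. Hartshorne, Algebraic Geometry (1977), II Prop. 7.16 (c).
-/

noncomputable section

open CategoryTheory AlgebraicGeometry TopologicalSpace

namespace Literature.AlgebraicGeometry.Resolution

universe u

open Literature.AlgebraicGeometry.Motives Literature.AlgebraicGeometry.RelativeSpec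

/-! ## Blow-up sequences over a projective scheme -/

/-- **The top of a blow-up sequence over a projective `k`-scheme is projective over `k`** (each blow-up of a
projective scheme is projective, Hartshorne II 7.16 (c) ∕ `IsBlowup.isProjectiveOver`, by induction on the sequence).
[cite: Hartshorne1977, II Prop. 7.16 (c), p. 166] -/
theorem CentreSeq.isProjectiveOver_top {k : Type u} [Field k] :
    ∀ {X : Scheme.{u}} (s : CentreSeq X) (f : X ⟶ Spec (.of k)),
      IsProjectiveOver (Over.mk f) → IsProjectiveOver (Over.mk (s.comp ≫ f))
  | X, CentreSeq.nil _, f, h => by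
    have e : (CentreSeq.nil X).comp ≫ f = f := by
      change 𝟙 X ≫ f = f
      exact Category.id_comp f
    exact isProjectiveOver_mk_congr e.symm h
  | _, CentreSeq.cons C rest, f, h => by
    have h1 : IsProjectiveOver (Over.mk (blowup.π C ≫ f)) := IsBlowup.isProjectiveOver f h (blowup.isBlowup C)
    have h2 := CentreSeq.isProjectiveOver_top rest (blowup.π C ≫ f) h1
    have e : (CentreSeq.cons C rest).comp ≫ f = rest.comp ≫ blowup.π C ≫ f := by
      change (rest.comp ≫ blowup.π C) ≫ f = _
      exact Category.assoc _ _ _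
    exact isProjectiveOver_mk_congr e.symm h2

/-! ## Kollár 3.36 + §3.4.1 in dimension ≤ 2 from CJS -/

/-- **Kollár's lifting fact at an integral projective scheme of dimension `≤ 2` over any field, from the
Cossart–Jannsen–Saito canonical resolution.** GIVEN `CossartJannsenSaito2020SequenceFunctorial`: for `X` integral and
projective over a field `k` with `dim X ≤ 2` there is a resolution `r : Y ⟶ X` (proper, birational, `Y` regular) with
`Y` projective over `k`, `r` an isomorphism over every open consisting of regular points, and, for every
`k`-automorphism `e` of `X`, some `e' : Y ⟶ Y` with `e' ≫ r = r ≫ e` — the conclusion of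
`Kollar2007_resolutionLiftsAutomorphisms` at `X`. [cite: CossartJannsenSaito2020, Thm. 1.2 (p. 5)]
[cite: Kollar2007, Thm. 3.36 (1)(2)(4) and §3.4.1 (p. 121)] [cite: Hartshorne1977, II Prop. 7.16 (c)] -/
theorem CossartJannsenSaito2020SequenceFunctorial.kollar336_conclusion_of_dim_le_two
    (hCJS : CossartJannsenSaito2020SequenceFunctorial.{u}) {k : Type u} [Field k] (X : SchemeOver k)
    [IsIntegral X.left] (hX : IsProjectiveOver X) (hd : topologicalKrullDim X.left ≤ 2) :
    ∃ (Y : Scheme.{u}) (r : Y ⟶ X.left), IsResolution r ∧ IsProjectiveOver (Over.mk (r ≫ X.hom)) ∧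
      (∀ U : X.left.Opens, (∀ x ∈ U, IsRegularLocalRing (X.left.presheaf.stalk x)) → IsIso (r ∣_ U)) ∧
      ∀ e : X.left ≅ X.left, e.hom ≫ X.hom = X.hom → ∃ e' : Y ⟶ Y, e' ≫ r = r ≫ e.hom := by
  obtain ⟨𝓢, h𝓢, hfun⟩ := hCJS
  haveI : IsProper X.hom := IsProjectiveOver.isProper hX
  haveI : IsLocallyNoetherian X.left := LocallyOfFiniteType.isLocallyNoetherian X.hom
  haveI : CompactSpace X.left := QuasiCompact.compactSpace_of_compactSpace X.hom
  haveI : IsNoetherian X.left := ⟨⟩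
  have hexc : Scheme.IsExcellent X.left :=
    Scheme.IsExcellent.of_locallyOfFiniteType X.hom
      (Scheme.isExcellent_Spec_of_isExcellentRing k (isExcellentRing_of_field k))
  obtain ⟨-, hsing, hreg⟩ := h𝓢 X.left hexc hd
  -- the regular locus: open, dense, missed by all centres
  let R : X.left.Opens :=
    ⟨Scheme.regularLocus X.left, isOpen_regularLocus_of_locallyOfFiniteType_field X.hom⟩
  have hover : (𝓢 X.left hexc hd).CentresOver (R : Set X.left)ᶜ := hsing.centresOver
  have hres : IsResolution (𝓢 X.left hexc hd).comp :=
    (𝓢 X.left hexc hd).isResolution_comp R (Scheme.dense_regularLocus X.left) hover hreg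
  refine ⟨(𝓢 X.left hexc hd).top, (𝓢 X.left hexc hd).comp, hres, ?_, ?_, ?_⟩
  · -- projectivity of the top
    exact (𝓢 X.left hexc hd).isProjectiveOver_top X.hom (isProjectiveOver_mk_hom hX)
  · -- isomorphism over every open of regular points
    intro U hU
    have hle : U ≤ R := fun x hx => hU x hx
    haveI := (𝓢 X.left hexc hd).isIso_comp_morphismRestrict R hover
    exact Morphisms.isIso_morphismRestrict_of_le _ hle
  · -- automorphisms lift: `𝓢 X = (𝓢 X|_e).prune`, transported along `pruneι ≫ restrictι`
    intro e _
    have h := hfun X.left X.left hexc hd hexc hd e.hom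
    -- an isomorphism of tops over `X` from the equation of sequences
    have key : ∀ {s t : CentreSeq X.left}, t = s → ∃ i : s.top ⟶ t.top, i ≫ t.comp = s.comp := by
      intro s t hst
      subst hst
      exact ⟨𝟙 _, Category.id_comp _⟩
    obtain ⟨i, hi⟩ := key h.symm
    refine ⟨i ≫ ((𝓢 X.left hexc hd).restrict e.hom).pruneι ≫ (𝓢 X.left hexc hd).restrictι e.hom, ?_⟩
    rw [Category.assoc, Category.assoc, ((𝓢 X.left hexc hd).isPullback_restrict e.hom).w,
      ← Category.assoc ((𝓢 X.left hexc hd).restrict e.hom).pruneι, CentreSeq.pruneι_comp, ← Category.assoc, hi]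

/-- **The same with a group action** (Kollár §3.4.1 for discrete groups, in dimension `≤ 2` from CJS): an action of a
group `G` on an integral projective `X` of dimension `≤ 2` over `k` lifts to the canonical resolution, for which the
resolution morphism is equivariant; the resolution is projective and an isomorphism over the regular locus.
[cite: CossartJannsenSaito2020, Thm. 1.2 (p. 5)] [cite: Kollar2007, Thm. 3.36 and §3.4.1 (p. 121)] -/
theorem CossartJannsenSaito2020SequenceFunctorial.exists_actionOver_of_dim_le_two
    (hCJS : CossartJannsenSaito2020SequenceFunctorial.{u}) {k : Type u} [Field k] (X : SchemeOver k)
    [IsIntegral X.left] (hX : IsProjectiveOver X) (hd : topologicalKrullDim X.left ≤ 2)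
    {G : Type*} [Group G] (ρ : ActionOver X.hom G) :
    ∃ (Y : Scheme.{u}) (r : Y ⟶ X.left) (ρY : ActionOver (r ≫ X.hom) G), IsResolution r ∧
      IsProjectiveOver (Over.mk (r ≫ X.hom)) ∧
      (∀ U : X.left.Opens, (∀ x ∈ U, IsRegularLocalRing (X.left.presheaf.stalk x)) → IsIso (r ∣_ U)) ∧
      ∀ g : G, (ρY.aut g).hom ≫ r = r ≫ (ρ.aut g).hom := by
  obtain ⟨Y, r, hr, hproj, hreg, hlift⟩ := hCJS.kollar336_conclusion_of_dim_le_two X hX hd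
  exact ⟨Y, r, ρ.resolutionLift hr hlift, hr, hproj, hreg, fun g => ρ.resolutionLift_hom_comp hr hlift g⟩

end Literature.AlgebraicGeometry.Resolution

end
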